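import Literature.Computation.Certificates.Data
import Literature.Computation.Certificates.PosSemidef
import Literature.Computation.Certificates.PosSemidefInt
import HarnessLib

/-!
# Certificate data carriers with `O(log n)` kernel lookup, and one-pass residual symmetry

Cell `turb-bounds` (pub-turb), T12 tooling of the shear lane (pub-turb-shear gen 4, 2026-08-21). Nothing in this
file is a trusted predicate: the PSD certificates of `Certs/*` are still checked by the audited predicates
`PSD.IsGramCert[DD]` / `PSD.IsGramCertZ` of `Literature/Computation/Certificates/*` (soundness proved once, in the
tree). This file only supplies

* `BT α` — a binary-tree DATA CARRIER with `BT.get t i` (`i : ℕ`; even positions in the left subtree, odd positions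
  in the right one), and the `Fin`-indexed readers `vecOfTree n t : Fin n → α`, `matrixOfTrees m n t :
  Matrix (Fin m) (Fin n) α` (a tree of row trees). A certificate predicate evaluated by `decide +kernel` looks every
  factor entry up `O(n³)` times; `List.getD` (the `matrixOfRows` carrier of `Certificates/Data.lean`) costs `O(n)`
  kernel reductions per lookup, a balanced tree `O(log n)`. As with `matrixOfRows`, an index past the data reads SOME
  leaf (junk) — the predicates quantify over `Fin n` only, and a wrong lookup can only make a check fail, never succeed
  wrongly (the carrier is untrusted data plumbing; soundness lives in the predicate).
* `gramResidualZ_symm` / `gramResidual_symm` — the residual `A − Bᵀ·diag d·B` is symmetric as soon as `A` is, so the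
  symmetry half of `PSD.IsDiagDominant[Z]` follows from an `n²` check on `A` instead of a second `n³` residual pass;
  packaged as `isGramCertZ_of_symm` / `isGramCertDD_of_symm`.

Measured (farm, 2026-08-21): a 58×58 integer Gram certificate (`PSD.IsGramCertZ`, 628-nonzero 106-bit factor in
tree carriers, one residual pass in row blocks of 10) kernel-checks in 60–64 s, where the same block in the rational
dd shape with list carriers (`PSD.IsGramCertDD`, two residual passes) was predicted ≈ 600 s from the measured 173 s at
38×38. HONEST FRAMING: rigorous bounds for the stated PDE and boundary conditions; no claim about physical turbulence
beyond the bound.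
-/

namespace Summit.NavierStokesRegularity.TurbBounds.CertCarriers

open Literature.Computation.Certificates Finset Matrix

/-- Binary-tree data carrier: `leaf a` holds one entry, `node l r` holds the entries at even positions in `l` and at
odd positions in `r` (so position `i` is found by following the binary digits of `i`, least significant first). -/
inductive BT (α : Type) where
  /-- a single entry -/
  | leaf : α → BT α
  /-- even positions left, odd positions right -/
  | node : BT α → BT α → BT α

/-- `O(log n)` positional lookup (`Nat.beq` / `%` / `/` on literals are kernel-accelerated). Written with the
recursor so that kernel reduction does not go through `brecOn`. -/
noncomputable def BT.get {α : Type} (t : BT α) : ℕ → α :=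
  BT.rec (motive := fun _ => ℕ → α) (fun a _ => a)
    (fun _ _ gl gr i => cond (Nat.beq (i % 2) 0) (gl (i / 2)) (gr (i / 2))) t

/-- A `Fin n`-indexed vector read from a tree. -/
noncomputable def vecOfTree {α : Type} (n : ℕ) (t : BT α) : Fin n → α :=
  fun i => t.get i.val

/-- An `m × n` matrix read from a tree of row trees: entry `(i, j)` is `(t.get i).get j`. -/
noncomputable def matrixOfTrees {α : Type} (m n : ℕ) (t : BT (BT α)) : Matrix (Fin m) (Fin n) α :=
  fun i j => (t.get i.val).get j.val

/-- `vecOfTree` unfolds to `BT.get`. -/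
theorem vecOfTree_apply {α : Type} (n : ℕ) (t : BT α) (i : Fin n) : vecOfTree n t i = t.get i.val := rfl

/-- `matrixOfTrees` unfolds to two `BT.get`s. -/
theorem matrixOfTrees_apply {α : Type} (m n : ℕ) (t : BT (BT α)) (i : Fin m) (j : Fin n) :
    matrixOfTrees m n t i j = (t.get i.val).get j.val := rfl

/-! ### Residual symmetry from the symmetry of `A` (one residual pass instead of two) -/

/-- The integer residual `A − Bᵀ·diag d·B` is symmetric as soon as `A` is. -/
theorem gramResidualZ_symm {n m : ℕ} {A : Matrix (Fin n) (Fin n) ℤ} {d : Fin m → ℕ}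
    {B : Matrix (Fin m) (Fin n) ℤ} (hA : ∀ i j, A i j = A j i) (i j : Fin n) :
    PSD.gramResidualZ A d B i j = PSD.gramResidualZ A d B j i := by
  show A i j - ∑ k, (d k : ℤ) * (B k i * B k j) = A j i - ∑ k, (d k : ℤ) * (B k j * B k i)
  rw [hA i j]
  congr 1
  exact Finset.sum_congr rfl fun k _ => by ring

/-- The rational residual `A − Bᵀ·diag d·B` is symmetric as soon as `A` is. -/
theorem gramResidual_symm {n m : ℕ} {A : Matrix (Fin n) (Fin n) ℚ} {d : Fin m → ℚ}
    {B : Matrix (Fin m) (Fin n) ℚ} (hA : ∀ i j, A i j = A j i) (i j : Fin n) :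
    PSD.gramResidual A d B i j = PSD.gramResidual A d B j i := by
  show A i j - ∑ k, d k * (B k i * B k j) = A j i - ∑ k, d k * (B k j * B k i)
  rw [hA i j]
  congr 1
  exact Finset.sum_congr rfl fun k _ => by ring

/-- **Integer rounded Gram certificate from one residual pass**: `A` symmetric (an `n²` check) and every residual
row diagonally dominant (the `n³` pass, typically split into row blocks with `forall_fin_of_blocks`). -/
theorem isGramCertZ_of_symm {n m : ℕ} {A : Matrix (Fin n) (Fin n) ℤ} {d : Fin m → ℕ}
    {B : Matrix (Fin m) (Fin n) ℤ} (hA : ∀ i j, A i j = A j i)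
    (hr : ∀ i, ∑ j ∈ Finset.univ.erase i, |PSD.gramResidualZ A d B i j| ≤ PSD.gramResidualZ A d B i i) :
    PSD.IsGramCertZ A d B :=
  PSD.IsDiagDominantZ.intro (gramResidualZ_symm hA) hr

/-- **Rational rounded Gram certificate from one residual pass** (`d ≥ 0`, `A` symmetric, rows dominant). -/
theorem isGramCertDD_of_symm {n m : ℕ} {A : Matrix (Fin n) (Fin n) ℚ} {d : Fin m → ℚ}
    {B : Matrix (Fin m) (Fin n) ℚ} (hd : ∀ k, 0 ≤ d k) (hA : ∀ i j, A i j = A j i)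
    (hr : ∀ i, ∑ j ∈ Finset.univ.erase i, |PSD.gramResidual A d B i j| ≤ PSD.gramResidual A d B i i) :
    PSD.IsGramCertDD A d B :=
  PSD.IsGramCertDD.intro hd (PSD.IsDiagDominant.intro (gramResidual_symm hA) hr)

/-! ### Tests (kernel-checked) -/

open BT in
/-- Test: positional lookup in a five-entry tree `[10, 11, 12, 13, 14]` (even positions left, odd right, recursively). -/
example : (node (node (node (leaf 10) (leaf 14)) (leaf (12 : ℕ))) (node (leaf 11) (leaf 13))).get 3 = 13 ∧
    (node (node (node (leaf 10) (leaf 14)) (leaf (12 : ℕ))) (node (leaf 11) (leaf 13))).get 4 = 14 ∧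
    (node (node (node (leaf 10) (leaf 14)) (leaf (12 : ℕ))) (node (leaf 11) (leaf 13))).get 0 = 10 := by
  decide +kernel

open BT in
/-- Test: a `3 × 3` integer Gram certificate with unit weights and a tree-carried `2 × 3` factor, one residual pass
(`A = [[2,-1,0],[-1,2,-1],[0,-1,2]]`, `F = [[1,-1,0],[0,1,-1]]`, residual `diag(1,0,1)`). -/
example : PSD.IsGramCertZ (matrixOfRows 3 3 [[2, -1, 0], [-1, 2, -1], [0, -1, 2]]) (fun _ : Fin 2 => 1)
    (matrixOfTrees 2 3 (node (leaf (node (node (leaf 1) (leaf 0)) (leaf (-1))))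
      (leaf (node (node (leaf 0) (leaf (-1))) (leaf 1))))) :=
  isGramCertZ_of_symm (by decide +kernel) (by decide +kernel)

end Summit.NavierStokesRegularity.TurbBounds.CertCarriers
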